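import Mathlib.RingTheory.Spectrum.Prime.FreeLocus
import Mathlib.RingTheory.Flat.TorsionFree
import Mathlib.RingTheory.DedekindDomain.Ideal.Lemmas
import Mathlib.RingTheory.Ideal.Norm.AbsNorm
import Mathlib.LinearAlgebra.TensorProduct.Quotient
import Mathlib.LinearAlgebra.Isomorphisms
import Mathlib.FieldTheory.Finiteness
import Mathlib.Algebra.Module.Submodule.Pointwise
import HarnessLib

/-!
# Ideal quotients and ideal torsion of a finitely generated torsion-free module over a Dedekind domain:
# `dim_{𝒪⧸𝔮} Λ⧸𝔮Λ = rk Λ`, `#(Λ⧸𝔞Λ) = N𝔞 ^ rk Λ`, `#{x ∈ Λ⧸nΛ | 𝔞x = 0} = N𝔞 ^ rk Λ` ([DummitFoote2004] §16.3 Thm. 22)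

Topic `Literature/Algebra/Module`; namespace `Literature.Algebra.Module.DedekindLattice` (shared with ★ `DedekindLatticeIsoClasses`,
Steinitz's splitting).  THEOREMS ONLY (no definition, no named fact, no `instance`, no notation, no `sorry`); pure Mathlib.
Cell `hodgecm-mathlib` (D-0151), FLOOR 0, P6 «MOD programme» (crux hLiu418 = stmt-HodgeConjecture-24832, `--supports`, count-neutral):
organ **(LAT) «DEDEKIND LATTICE IDEAL-QUOTIENT COUNT»** of the GENERIC-FIBRE road (LDEAL v1 §L1 T2: «the characteristic-0 `𝒪⧸𝔭`-module
structure of `A_K[𝔭](K̄)`, rank `N𝔭^{2g∕[F:ℚ]}`»; H4 ORDER-INPUT census of line L3, item (2): «no ★ statement gives `#A[𝔞] = N𝔞^r`»).  It is the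
module-theoretic half of the classical count of ideal-torsion points of an abelian variety with multiplication by an order `𝒪`: over `ℂ`,
`A[n](ℂ) ≃ Λ⧸nΛ` with `Λ = H₁(A(ℂ); ℤ)` (★ `AlgebraicGeometry/HodgeTheory/AbelianVarietyTorsionPointsHomology.modNHOneEquivTorsionPoints`, natural in
endomorphisms), `Λ` is a finitely generated torsion-free `𝒪`-module of rank `r = 2 dim A ∕ [F:ℚ]`, and `A[𝔞](ℂ) = {x ∈ A[n](ℂ) | 𝔞x = 0}` for
`0 ≠ n ∈ 𝔞`; the present file supplies `#{x ∈ Λ⧸nΛ | 𝔞x = 0} = N𝔞^r` and the `𝒪⧸𝔮`-dimension `r` of the `𝔮`-torsion.  (The transport to an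
arbitrary algebraically closed field and to the special fibre is ★ `AbelianSchemes/IdealTorsionGenericFibreEtale`; composite ideals on the
divisible side are ★ `DivisibleTorsionMultiplicativity`.)  HC_CM is proved only modulo the printed citations (2 remaining named inputs hLiu418 24832,
h413 24833) until rung 0 closes; this file is generic and changes no count.

THE MATHEMATICS.  Let `𝒪` be a Dedekind domain and `Λ` a finitely generated torsion-free `𝒪`-module of rank `r` (`Module.finrank 𝒪 Λ`, the
dimension of `Λ ⊗ Frac 𝒪`).  [DummitFoote2004] §16.3 Thm. 22: `Λ ≅ 𝒪^{r-1} ⊕ I` for an ideal `I ≠ 0`, whence `Λ⧸𝔞Λ ≅ (𝒪⧸𝔞)^{r-1} ⊕ I⧸𝔞I` has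
`N𝔞^r` elements; and (proof of Thm. 22, uniqueness) for a maximal `𝔮`, `𝔮^{i-1}Λ⧸𝔮^iΛ` is an `𝒪⧸𝔮`-vector space.  We do not use the structure
theorem: torsion-free over a Dedekind domain is FLAT (Mathlib `RingTheory/Flat/TorsionFree`), and for a finite flat module over a domain the fibre
rank at every prime equals the generic rank (Mathlib `Ideal.finrank_fiber_eq_finrank`: `dim_{κ(𝔮)} κ(𝔮) ⊗ Λ = rk Λ`), so
**`dim_{𝒪⧸𝔮} Λ⧸𝔮Λ = r`** and `#(Λ⧸𝔮Λ) = #(𝒪⧸𝔮)^r` (§1, any domain).  The tower `Λ ⊇ IΛ ⊇ IJΛ` gives `#(Λ⧸IJΛ) = #(Λ⧸IΛ)·#(IΛ⧸J(IΛ))`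
(§2, any ring), `IΛ` is again finitely generated torsion-free of the same rank for `I ≠ 0` (§3, `x ↦ a•x` is injective), so by induction on the
factorisation **`#(Λ⧸𝔞Λ) = N𝔞^r`** for every `𝔞 ≠ 0` when `N` is multiplicative (`𝒪` a `ℤ`-order, Mathlib `Ideal.absNorm`; §4).  Finally, for
`0 ≠ n ∈ 𝔞` write `(n) = 𝔞𝔠`; then `{x ∈ Λ | 𝔞x ⊆ nΛ} = 𝔠Λ` (⊇ clear; ⊆: `𝔠𝔞x ⊆ 𝔠·𝔞𝔠Λ = n𝔠Λ`, so `n x ∈ n𝔠Λ` and `x ∈ 𝔠Λ` by torsion-freeness),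
i.e. **`(Λ⧸nΛ)[𝔞] = 𝔠Λ⧸nΛ = 𝔠Λ⧸𝔞(𝔠Λ)`**, which has `N𝔞^r` elements and, for `𝔞 = 𝔮` maximal, `𝒪⧸𝔮`-dimension `r` (§4).

## Contents
* §1 (domain `𝒪`, `Λ` finite flat, `𝔮` maximal) `finrank_quotient_tensor_eq_finrank` (`dim_{𝒪⧸𝔮} (𝒪⧸𝔮) ⊗ Λ = rk Λ`),
  **`finrank_quotient_smul_top_eq_finrank`** (`dim_{𝒪⧸𝔮} Λ⧸𝔮Λ = rk Λ`), **`natCard_quotient_smul_top_of_isMaximal`** (`#(Λ⧸𝔮Λ) = #(𝒪⧸𝔮)^{rk Λ}`).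
* §2 (any ring) `comap_subtype_mul_smul_top`, `nonempty_smul_top_quotient_equiv_map_mkQ` (`IΛ⧸J(IΛ) ≃ 𝔦𝔪(IΛ → Λ⧸IJΛ)`), `natCard_map_mkQ_smul_top`,
  **`natCard_quotient_mul_smul_top`** (`#(Λ⧸IJΛ) = #(Λ⧸IΛ)·#(IΛ⧸J(IΛ))`).
* §3 (domain, `Λ` finite torsion-free) **`finrank_smul_top_eq`** (`rk IΛ = rk Λ` for `I ≠ 0`).
* §4 (Dedekind `𝒪`, `Λ` finite torsion-free) `torsionBySet_quotient_eq_map` (`(Λ⧸nΛ)[𝔮] = 𝔠Λ⧸nΛ` for `𝔮𝔠 = (n)`),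
  **`natCard_torsionBySet_quotient_of_isMaximal`** ∕ **`natCard_subtype_quotient_torsion_of_isMaximal`** (`#{x ∈ Λ⧸nΛ | 𝔮x = 0} = #(𝒪⧸𝔮)^{rk Λ}`),
  **`finrank_torsionBySet_quotient_of_isMaximal`** (`dim_{𝒪⧸𝔮} (Λ⧸nΛ)[𝔮] = rk Λ`); for `𝒪` a `ℤ`-order (`Module.Free ℤ 𝒪`, `Module.Finite ℤ 𝒪`):
  **`natCard_quotient_smul_top`** (`#(Λ⧸𝔞Λ) = N𝔞^{rk Λ}`), **`natCard_subtype_quotient_torsion`** (`#{x ∈ Λ⧸nΛ | 𝔞x = 0} = N𝔞^{rk Λ}`).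
* §5 (ED. 2; any presentation `π : Λ → Q` of `Λ⧸nΛ` intertwining the action with self-maps `ψ a` of `Q`) `natCard_subtype_torsion_eq_of_presentation`
  (`#{q ∈ Q | 𝔞q = 0} = #(Λ⧸nΛ)[𝔞]`), **`natCard_subtype_torsion_of_presentation_of_isMaximal`**, **`natCard_subtype_torsion_of_presentation_eq_absNorm_pow`**.

## References
* [DummitFoote2004] D. S. Dummit, R. M. Foote, *Abstract Algebra*, 3rd ed. (2004), §16.3 Theorem 22 (structure of finitely generated modules over a
  Dedekind domain; rank; `P^{i-1}M⧸P^iM` a vector space over `R⧸P`), Corollary 23 (projective ⇔ torsion free); §10.2 Theorem 4 (1)–(3) (isomorphism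
  theorems for modules).
* [Reiner2003MaximalOrders] I. Reiner, *Maximal Orders* (2003), §4 (modules over Dedekind domains, Steinitz's theorem).
-/

set_option autoImplicit false

open Module Submodule
open scoped TensorProduct Pointwise

namespace Literature.Algebra.Module.DedekindLattice

universe u v

/-! ## §1 The prime case over a domain: `dim_{𝒪⧸𝔮} Λ⧸𝔮Λ = rk_𝒪 Λ` -/

section Prime

variable {O : Type u} [CommRing O] [IsDomain O] {Λ : Type v} [AddCommGroup Λ] [Module O Λ]
  [Module.Finite O Λ] [Module.Flat O Λ]

/-- **`dim_{𝒪⧸𝔮} (𝒪⧸𝔮) ⊗_𝒪 Λ = rk_𝒪 Λ`** for a finite flat module `Λ` over a domain `𝒪` and a maximal ideal `𝔮` (Mathlib's fibre rank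
`Ideal.finrank_fiber_eq_finrank` at `κ(𝔮)`, descended along the bijection `𝒪⧸𝔮 → κ(𝔮)`). [cite: DummitFoote2004, §16.3 Thm. 22] -/
theorem finrank_quotient_tensor_eq_finrank (𝔮 : Ideal O) [𝔮.IsMaximal] :
    finrank (O ⧸ 𝔮) ((O ⧸ 𝔮) ⊗[O] Λ) = finrank O Λ := by
  letI : Field (O ⧸ 𝔮) := Ideal.Quotient.field 𝔮
  have e := TensorProduct.AlgebraTensorModule.cancelBaseChange O (O ⧸ 𝔮) 𝔮.ResidueField 𝔮.ResidueField Λ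
  rw [← Ideal.finrank_fiber_eq_finrank (M := Λ) 𝔮, ← e.finrank_eq, Module.finrank_baseChange (S := O ⧸ 𝔮)]

/-- **`dim_{𝒪⧸𝔮} Λ⧸𝔮Λ = rk_𝒪 Λ`** for a finite flat (e.g. torsion-free over a Dedekind domain) module `Λ` over a domain `𝒪` and a maximal
ideal `𝔮`. [cite: DummitFoote2004, §16.3 Thm. 22] -/
theorem finrank_quotient_smul_top_eq_finrank (𝔮 : Ideal O) [𝔮.IsMaximal] :
    finrank (O ⧸ 𝔮) (Λ ⧸ 𝔮 • (⊤ : Submodule O Λ)) = finrank O Λ := by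
  let e₀ := TensorProduct.quotTensorEquivQuotSMul Λ 𝔮
  have e : ((O ⧸ 𝔮) ⊗[O] Λ) ≃ₗ[O ⧸ 𝔮] (Λ ⧸ 𝔮 • (⊤ : Submodule O Λ)) :=
    e₀.toAddEquiv.toLinearEquiv (by
      intro c x
      obtain ⟨r, rfl⟩ := Ideal.Quotient.mk_surjective c
      change e₀ (Ideal.Quotient.mk 𝔮 r • x) = Ideal.Quotient.mk 𝔮 r • e₀ x
      rw [← Ideal.Quotient.algebraMap_eq, algebraMap_smul, algebraMap_smul, e₀.map_smul])
  rw [← e.finrank_eq, finrank_quotient_tensor_eq_finrank]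

/-- **`#(Λ⧸𝔮Λ) = #(𝒪⧸𝔮) ^ rk_𝒪 Λ`** (as `Nat.card`; both sides `0` when `𝒪⧸𝔮` is infinite and `rk Λ > 0`). [cite: DummitFoote2004, §16.3 Thm. 22] -/
theorem natCard_quotient_smul_top_of_isMaximal (𝔮 : Ideal O) [𝔮.IsMaximal] :
    Nat.card (Λ ⧸ 𝔮 • (⊤ : Submodule O Λ)) = Nat.card (O ⧸ 𝔮) ^ finrank O Λ := by
  letI : Field (O ⧸ 𝔮) := Ideal.Quotient.field 𝔮
  rw [← Nat.card_congr (TensorProduct.quotTensorEquivQuotSMul Λ 𝔮).toEquiv,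
    Module.natCard_eq_pow_finrank (K := O ⧸ 𝔮), finrank_quotient_tensor_eq_finrank]

end Prime

/-! ## §2 The tower `Λ ⊇ IΛ ⊇ IJΛ` -/

section Tower

variable {O : Type u} [CommRing O] {Λ : Type v} [AddCommGroup Λ] [Module O Λ]

/-- `IJΛ ∩ IΛ = J(IΛ)` inside `IΛ`: the pull-back of `(IJ)Λ` along the inclusion `IΛ ↪ Λ` is `J • ⊤` (the kernel of `IΛ ↪ Λ ↠ Λ⧸IJΛ`).
[cite: DummitFoote2004, §10.2 Thm. 4 (1)] -/
theorem comap_subtype_mul_smul_top (I J : Ideal O) :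
    ((I * J) • (⊤ : Submodule O Λ)).comap (I • (⊤ : Submodule O Λ)).subtype =
      J • (⊤ : Submodule O ↥(I • (⊤ : Submodule O Λ))) := by
  have hmap : (J • (⊤ : Submodule O ↥(I • (⊤ : Submodule O Λ)))).map (I • (⊤ : Submodule O Λ)).subtype =
      (I * J) • (⊤ : Submodule O Λ) := by
    rw [Submodule.map_smul'', Submodule.map_top, Submodule.range_subtype, mul_comm, Submodule.mul_smul]
  rw [← hmap, Submodule.comap_map_eq_of_injective (Submodule.injective_subtype _)]

/-- **`IΛ⧸J(IΛ) ≃ IΛ⧸T`** (the image of `IΛ` in `Λ⧸T`, as `𝒪`-modules) whenever `T = IJ • Λ` (first isomorphism theorem for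
`IΛ ↪ Λ ↠ Λ⧸T`). [cite: DummitFoote2004, §10.2 Thm. 4 (1)] -/
theorem nonempty_smul_top_quotient_equiv_map_mkQ (I J : Ideal O) (T : Submodule O Λ)
    (hT : T = (I * J) • (⊤ : Submodule O Λ)) :
    Nonempty ((↥(I • (⊤ : Submodule O Λ)) ⧸ J • (⊤ : Submodule O ↥(I • (⊤ : Submodule O Λ)))) ≃ₗ[O]
      ↥((I • (⊤ : Submodule O Λ)).map T.mkQ)) := by
  subst hT
  set S : Submodule O Λ := I • ⊤
  have hker : LinearMap.ker ((((I * J) • (⊤ : Submodule O Λ))).mkQ.comp S.subtype) =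
      J • (⊤ : Submodule O ↥S) := by
    rw [LinearMap.ker_comp, Submodule.ker_mkQ]
    exact comap_subtype_mul_smul_top I J
  have hrange : LinearMap.range ((((I * J) • (⊤ : Submodule O Λ))).mkQ.comp S.subtype) =
      S.map (((I * J) • (⊤ : Submodule O Λ))).mkQ := by
    rw [LinearMap.range_comp, Submodule.range_subtype]
  exact ⟨(Submodule.quotEquivOfEq _ _ hker).symm ≪≫ₗ (LinearMap.quotKerEquivRange _) ≪≫ₗ
    LinearEquiv.ofEq _ _ hrange⟩

/-- `#(image of IΛ in Λ⧸T) = #(IΛ⧸J(IΛ))` whenever `T = IJ • Λ` (first isomorphism theorem). [cite: DummitFoote2004, §10.2 Thm. 4 (1)] -/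
theorem natCard_map_mkQ_smul_top (I J : Ideal O) (T : Submodule O Λ) (hT : T = (I * J) • (⊤ : Submodule O Λ)) :
    Nat.card ↥((I • (⊤ : Submodule O Λ)).map T.mkQ) =
      Nat.card (↥(I • (⊤ : Submodule O Λ)) ⧸ J • (⊤ : Submodule O ↥(I • (⊤ : Submodule O Λ)))) := by
  obtain ⟨e⟩ := nonempty_smul_top_quotient_equiv_map_mkQ I J T hT
  exact (Nat.card_congr e.toEquiv).symm

/-- **THE TOWER `#(Λ⧸IJΛ) = #(Λ⧸IΛ) · #(IΛ⧸J(IΛ))`** (any commutative ring, any module; as `Nat.card`): the third isomorphism theorem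
`(Λ⧸IJΛ)⧸(IΛ⧸IJΛ) ≅ Λ⧸IΛ` and Lagrange. [cite: DummitFoote2004, §10.2 Thm. 4 (3)] -/
theorem natCard_quotient_mul_smul_top (I J : Ideal O) :
    Nat.card (Λ ⧸ (I * J) • (⊤ : Submodule O Λ)) =
      Nat.card (Λ ⧸ I • (⊤ : Submodule O Λ)) *
        Nat.card (↥(I • (⊤ : Submodule O Λ)) ⧸ J • (⊤ : Submodule O ↥(I • (⊤ : Submodule O Λ)))) := by
  have hTS : (I * J) • (⊤ : Submodule O Λ) ≤ I • ⊤ := Submodule.smul_mono_left Ideal.mul_le_right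
  rw [← Submodule.card_quotient_mul_card_quotient _ _ hTS, natCard_map_mkQ_smul_top I J _ rfl, mul_comm]

end Tower

/-! ## §3 Rank of a full sublattice `IΛ` -/

section Rank

variable {O : Type u} [CommRing O] [IsDomain O] {Λ : Type v} [AddCommGroup Λ] [Module O Λ]
  [Module.Finite O Λ] [Module.IsTorsionFree O Λ]

/-- **`rk_𝒪 IΛ = rk_𝒪 Λ` for `I ≠ 0`**, `Λ` finitely generated torsion-free over a Noetherian domain (`IΛ ≤ Λ`, and `x ↦ a • x`, `0 ≠ a ∈ I`, embeds
`Λ` into `IΛ`). [cite: DummitFoote2004, §16.3 Thm. 22] -/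
theorem finrank_smul_top_eq [IsNoetherianRing O] (I : Ideal O) (hI : I ≠ ⊥) :
    finrank O ↥(I • (⊤ : Submodule O Λ)) = finrank O Λ := by
  obtain ⟨a, haI, ha0⟩ := Submodule.exists_mem_ne_zero_of_ne_bot hI
  haveI : IsNoetherian O Λ := isNoetherian_of_isNoetherianRing_of_finite O Λ
  refine le_antisymm (Submodule.finrank_le _) ?_
  let f : Λ →ₗ[O] ↥(I • (⊤ : Submodule O Λ)) :=
    (LinearMap.lsmul O Λ a).codRestrict (I • ⊤) (fun x => Submodule.smul_mem_smul haI Submodule.mem_top)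
  have hf : Function.Injective f := by
    intro x y hxy
    have h := congrArg Subtype.val hxy
    exact smul_right_injective Λ ha0 h
  exact LinearMap.finrank_le_finrank_of_injective hf

end Rank

/-! ## §4 Dedekind domain: the `𝔮`-torsion of `Λ ⧸ nΛ`, and all nonzero ideals -/

section Dedekind

variable {O : Type u} [CommRing O] [IsDedekindDomain O] {Λ : Type v} [AddCommGroup Λ] [Module O Λ]

/-- **`(Λ⧸nΛ)[𝔮] = 𝔠Λ⧸nΛ` for `𝔮𝔠 = (n)`, `n ≠ 0`**: the `𝔮`-torsion of `Λ⧸nΛ` is the image of `𝔠Λ` (⊇: `𝔮𝔠Λ = nΛ`; ⊆: if `𝔮x ⊆ nΛ` then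
`(𝔠𝔮)x ⊆ n𝔠Λ`, so `nx ∈ n𝔠Λ` and `x ∈ 𝔠Λ` by torsion-freeness).  Any ideals `𝔮`, `𝔠` of the Dedekind domain `𝒪`. [cite: DummitFoote2004, §16.3 Thm. 22] -/
theorem torsionBySet_quotient_eq_map [Module.IsTorsionFree O Λ] (𝔮 𝔠 : Ideal O) (n : O) (hn : n ≠ 0)
    (h : 𝔮 * 𝔠 = Ideal.span {n}) :
    torsionBySet O (Λ ⧸ n • (⊤ : Submodule O Λ)) (𝔮 : Set O) =
      (𝔠 • (⊤ : Submodule O Λ)).map (n • (⊤ : Submodule O Λ)).mkQ := by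
  have hT : n • (⊤ : Submodule O Λ) = (𝔮 * 𝔠) • ⊤ := by rw [h, Submodule.ideal_span_singleton_smul]
  ext z
  constructor
  · intro hz
    obtain ⟨x, rfl⟩ := Submodule.mkQ_surjective (n • (⊤ : Submodule O Λ)) z
    have h1 : ∀ a ∈ 𝔮, a • x ∈ n • (⊤ : Submodule O Λ) := fun a ha => by
      have h' := (Submodule.mem_torsionBySet_iff _ _).mp hz ⟨a, ha⟩
      rwa [← map_smul, Submodule.mkQ_apply, Submodule.Quotient.mk_eq_zero] at h'
    have h2 : ∀ s ∈ 𝔠 * 𝔮, s • x ∈ n • (𝔠 • (⊤ : Submodule O Λ)) := by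
      intro s hs
      refine Submodule.mul_induction_on hs (fun c hc a ha => ?_) (fun s t hs ht => ?_)
      · rw [mul_smul]
        obtain ⟨y, -, hyx⟩ := (Submodule.mem_smul_pointwise_iff_exists _ _ _).mp (h1 a ha)
        rw [← hyx, smul_comm c n y]
        exact Submodule.smul_mem_pointwise_smul _ _ _ (Submodule.smul_mem_smul hc Submodule.mem_top)
      · rw [add_smul]
        exact add_mem hs ht
    have h3 : n • x ∈ n • (𝔠 • (⊤ : Submodule O Λ)) :=
      h2 n (by rw [mul_comm, h]; exact Ideal.mem_span_singleton_self n)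
    obtain ⟨y, hy, hyx⟩ := (Submodule.mem_smul_pointwise_iff_exists _ _ _).mp h3
    have hxy : y = x := smul_right_injective Λ hn hyx
    exact ⟨y, hy, by rw [hxy]⟩
  · rintro ⟨y, hy, rfl⟩
    rw [Submodule.mem_torsionBySet_iff]
    rintro ⟨a, ha⟩
    change a • (n • (⊤ : Submodule O Λ)).mkQ y = 0
    rw [← map_smul, Submodule.mkQ_apply, Submodule.Quotient.mk_eq_zero, hT, Submodule.mul_smul]
    exact Submodule.smul_mem_smul ha hy

variable [Module.Finite O Λ] [Module.IsTorsionFree O Λ]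

/-- **`#(Λ⧸nΛ)[𝔮] = #(𝒪⧸𝔮) ^ rk_𝒪 Λ`** for a maximal `𝔮 ∋ n`, `n ≠ 0`, `Λ` finitely generated torsion-free over the Dedekind domain `𝒪`
(`Submodule.torsionBySet` spelling). [cite: DummitFoote2004, §16.3 Thm. 22] -/
theorem natCard_torsionBySet_quotient_of_isMaximal (𝔮 : Ideal O) [𝔮.IsMaximal] {n : O} (hn : n ≠ 0)
    (hn𝔮 : n ∈ 𝔮) :
    Nat.card ↥(torsionBySet O (Λ ⧸ n • (⊤ : Submodule O Λ)) (𝔮 : Set O)) =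
      Nat.card (O ⧸ 𝔮) ^ finrank O Λ := by
  obtain ⟨𝔠, h𝔠⟩ : 𝔮 ∣ Ideal.span {n} :=
    Ideal.dvd_iff_le.mpr ((Ideal.span_singleton_le_iff_mem _).mpr hn𝔮)
  have h𝔠0 : 𝔠 ≠ ⊥ := by
    rintro rfl
    rw [Ideal.mul_bot, Ideal.span_singleton_eq_bot] at h𝔠
    exact hn h𝔠
  have hT : n • (⊤ : Submodule O Λ) = (𝔠 * 𝔮) • ⊤ := by
    rw [mul_comm, ← h𝔠, Submodule.ideal_span_singleton_smul]
  rw [torsionBySet_quotient_eq_map 𝔮 𝔠 n hn h𝔠.symm, natCard_map_mkQ_smul_top 𝔠 𝔮 _ hT,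
    natCard_quotient_smul_top_of_isMaximal 𝔮, finrank_smul_top_eq 𝔠 h𝔠0]

/-- **`#{x ∈ Λ⧸nΛ | 𝔮x = 0} = #(𝒪⧸𝔮) ^ rk_𝒪 Λ`** for a maximal `𝔮 ∋ n`, `n ≠ 0` (subtype spelling — the shape of the torsion-point counts
`{t | ∀ a ∈ 𝔮, ι(a) t = 1}` downstream). [cite: DummitFoote2004, §16.3 Thm. 22] -/
theorem natCard_subtype_quotient_torsion_of_isMaximal (𝔮 : Ideal O) [𝔮.IsMaximal] {n : O} (hn : n ≠ 0)
    (hn𝔮 : n ∈ 𝔮) :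
    Nat.card {x : Λ ⧸ n • (⊤ : Submodule O Λ) // ∀ a ∈ 𝔮, a • x = 0} = Nat.card (O ⧸ 𝔮) ^ finrank O Λ := by
  rw [← natCard_torsionBySet_quotient_of_isMaximal (Λ := Λ) 𝔮 hn hn𝔮]
  refine Nat.card_congr (Equiv.subtypeEquivRight fun x => ?_)
  rw [Submodule.mem_torsionBySet_iff]
  exact ⟨fun h a => h a.1 a.2, fun h a ha => h ⟨a, ha⟩⟩

/-- **`dim_{𝒪⧸𝔮} (Λ⧸nΛ)[𝔮] = rk_𝒪 Λ`** (the `𝒪⧸𝔮`-MODULE STRUCTURE of the `𝔮`-torsion of `Λ⧸nΛ`: a vector space of dimension `rk Λ`), for a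
maximal `𝔮 ∋ n`, `n ≠ 0`. [cite: DummitFoote2004, §16.3 Thm. 22] -/
theorem finrank_torsionBySet_quotient_of_isMaximal (𝔮 : Ideal O) [𝔮.IsMaximal] {n : O} (hn : n ≠ 0)
    (hn𝔮 : n ∈ 𝔮) :
    finrank (O ⧸ 𝔮) ↥(torsionBySet O (Λ ⧸ n • (⊤ : Submodule O Λ)) (𝔮 : Set O)) = finrank O Λ := by
  obtain ⟨𝔠, h𝔠⟩ : 𝔮 ∣ Ideal.span {n} :=
    Ideal.dvd_iff_le.mpr ((Ideal.span_singleton_le_iff_mem _).mpr hn𝔮)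
  have h𝔠0 : 𝔠 ≠ ⊥ := by
    rintro rfl
    rw [Ideal.mul_bot, Ideal.span_singleton_eq_bot] at h𝔠
    exact hn h𝔠
  have hT : n • (⊤ : Submodule O Λ) = (𝔠 * 𝔮) • ⊤ := by
    rw [mul_comm, ← h𝔠, Submodule.ideal_span_singleton_smul]
  obtain ⟨e⟩ := nonempty_smul_top_quotient_equiv_map_mkQ 𝔠 𝔮 _ hT
  have e' := e ≪≫ₗ LinearEquiv.ofEq _ _ (torsionBySet_quotient_eq_map (Λ := Λ) 𝔮 𝔠 n hn h𝔠.symm).symm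
  have e'' : (↥(𝔠 • (⊤ : Submodule O Λ)) ⧸ 𝔮 • (⊤ : Submodule O ↥(𝔠 • (⊤ : Submodule O Λ)))) ≃ₗ[O ⧸ 𝔮]
      ↥(torsionBySet O (Λ ⧸ n • (⊤ : Submodule O Λ)) (𝔮 : Set O)) :=
    e'.toAddEquiv.toLinearEquiv (by
      intro c x
      obtain ⟨r, rfl⟩ := Ideal.Quotient.mk_surjective c
      change e' (Ideal.Quotient.mk 𝔮 r • x) = Ideal.Quotient.mk 𝔮 r • e' x
      rw [← Ideal.Quotient.algebraMap_eq, algebraMap_smul, algebraMap_smul, e'.map_smul])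
  rw [← e''.finrank_eq, finrank_quotient_smul_top_eq_finrank 𝔮, finrank_smul_top_eq 𝔠 h𝔠0]

/-- **`#(Λ⧸𝔞Λ) = N𝔞 ^ rk_𝒪 Λ` for every nonzero ideal `𝔞`**, `Λ` finitely generated torsion-free over a Dedekind domain `𝒪` which is a `ℤ`-order
(`Module.Free ℤ 𝒪`, `Module.Finite ℤ 𝒪`: rings of integers), `N𝔞 = Ideal.absNorm 𝔞 = #(𝒪⧸𝔞)` (induction on the factorisation of `𝔞` through
the tower §2, the prime case §1 and `rk 𝔮Λ = rk Λ` §3). [cite: DummitFoote2004, §16.3 Thm. 22] -/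
theorem natCard_quotient_smul_top [Module.Free ℤ O] [Module.Finite ℤ O] (𝔞 : Ideal O) (h𝔞 : 𝔞 ≠ ⊥) :
    Nat.card (Λ ⧸ 𝔞 • (⊤ : Submodule O Λ)) = Ideal.absNorm 𝔞 ^ finrank O Λ := by
  suffices H : ∀ (𝔟 : Ideal O), 𝔟 ≠ ⊥ → ∀ (M : Type v) [AddCommGroup M] [Module O M] [Module.Finite O M]
      [Module.IsTorsionFree O M], Nat.card (M ⧸ 𝔟 • (⊤ : Submodule O M)) = Ideal.absNorm 𝔟 ^ finrank O M from
    H 𝔞 h𝔞 Λ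
  intro 𝔟
  induction 𝔟 using UniqueFactorizationMonoid.induction_on_prime with
  | h₁ => intro h; exact absurd rfl h
  | h₂ 𝔟 h𝔟 =>
    intro _ M _ _ _ _
    rw [Ideal.isUnit_iff] at h𝔟
    subst h𝔟
    rw [Submodule.top_smul, Ideal.absNorm_top, one_pow, ← Submodule.cardQuot_apply, Submodule.cardQuot_top]
  | h₃ 𝔟 𝔮 h𝔟0 h𝔮 IH =>
    intro _ M _ _ _ _
    have h𝔮0 : 𝔮 ≠ ⊥ := h𝔮.ne_zero
    haveI : 𝔮.IsMaximal := (Ideal.isPrime_of_prime h𝔮).isMaximal h𝔮0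
    rw [natCard_quotient_mul_smul_top 𝔮 𝔟, IH h𝔟0 ↥(𝔮 • (⊤ : Submodule O M)), finrank_smul_top_eq 𝔮 h𝔮0,
      natCard_quotient_smul_top_of_isMaximal 𝔮, map_mul, mul_pow]
    simp only [Ideal.absNorm_apply, Submodule.cardQuot_apply]

/-- **`#{x ∈ Λ⧸nΛ | 𝔞x = 0} = N𝔞 ^ rk_𝒪 Λ`** for every nonzero ideal `𝔞 ∋ n`, `n ≠ 0` (`𝒪` a Dedekind `ℤ`-order, `Λ` finitely generated
torsion-free): with `(n) = 𝔞𝔠`, `(Λ⧸nΛ)[𝔞] = 𝔠Λ⧸𝔞(𝔠Λ)`. [cite: DummitFoote2004, §16.3 Thm. 22] -/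
theorem natCard_subtype_quotient_torsion [Module.Free ℤ O] [Module.Finite ℤ O] (𝔞 : Ideal O) (h𝔞 : 𝔞 ≠ ⊥)
    {n : O} (hn : n ≠ 0) (hn𝔞 : n ∈ 𝔞) :
    Nat.card {x : Λ ⧸ n • (⊤ : Submodule O Λ) // ∀ a ∈ 𝔞, a • x = 0} = Ideal.absNorm 𝔞 ^ finrank O Λ := by
  obtain ⟨𝔠, h𝔠⟩ : 𝔞 ∣ Ideal.span {n} :=
    Ideal.dvd_iff_le.mpr ((Ideal.span_singleton_le_iff_mem _).mpr hn𝔞)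
  have h𝔠0 : 𝔠 ≠ ⊥ := by
    rintro rfl
    rw [Ideal.mul_bot, Ideal.span_singleton_eq_bot] at h𝔠
    exact hn h𝔠
  have hT : n • (⊤ : Submodule O Λ) = (𝔠 * 𝔞) • ⊤ := by
    rw [mul_comm, ← h𝔠, Submodule.ideal_span_singleton_smul]
  have h1 : Nat.card {x : Λ ⧸ n • (⊤ : Submodule O Λ) // ∀ a ∈ 𝔞, a • x = 0} =
      Nat.card ↥(torsionBySet O (Λ ⧸ n • (⊤ : Submodule O Λ)) (𝔞 : Set O)) := by
    refine Nat.card_congr (Equiv.subtypeEquivRight fun x => ?_)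
    rw [Submodule.mem_torsionBySet_iff]
    exact ⟨fun h a => h a.1 a.2, fun h a ha => h ⟨a, ha⟩⟩
  rw [h1, torsionBySet_quotient_eq_map 𝔞 𝔠 n hn h𝔠.symm, natCard_map_mkQ_smul_top 𝔠 𝔞 _ hT,
    natCard_quotient_smul_top 𝔞 h𝔞, finrank_smul_top_eq 𝔠 h𝔠0]

end Dedekind

/-! ## §5 Presentation-free torsion form: counting the `𝔞`-torsion of any quotient `Q` of `Λ` by `nΛ`

For the geometric consumer (`Q = A(ℂ)`, `π = (H₁(A(ℂ);ℤ) → H₁⧸n ≃ A[n](ℂ) ⊆ A(ℂ))`, `ψ a =` the action of `ι(a)`): the count is transported along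
ANY additive `π : Λ → Q` killing exactly `nΛ`, intertwining the action with self-maps `ψ a` of `Q`, with image ⊇ the `𝔞`-torsion of `Q`. -/

section Transport

universe w

variable {O : Type u} [CommRing O] {Λ : Type v} [AddCommGroup Λ] [Module O Λ] {Q : Type w} [AddCommGroup Q]

/-- **Transport of the torsion count along a presentation `π : Λ → Q` of `Λ⧸nΛ`** (any commutative ring `𝒪`, any module `Λ`,
any ideal `𝔞`, any `n`).  If `π` is additive with `π x = 0 ↔ x ∈ nΛ`, `π (a • x) = ψ a (π x)`, and every `q` with `ψ a q = 0` for
all `a ∈ 𝔞` is in the image of `π`, then `#{q | ∀ a ∈ 𝔞, ψ a q = 0} = #{x̄ ∈ Λ⧸nΛ | 𝔞 x̄ = 0}` (the bijection `x̄ ↦ π x`, first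
isomorphism theorem). [cite: DummitFoote2004, §10.2 Thm. 4 (1)] -/
theorem natCard_subtype_torsion_eq_of_presentation (ψ : O → Q → Q) (𝔞 : Ideal O)
    (n : O) (π : Λ →+ Q) (hker : ∀ x, π x = 0 ↔ x ∈ n • (⊤ : Submodule O Λ)) (hcomp : ∀ a x, π (a • x) = ψ a (π x))
    (hrange : ∀ q, (∀ a ∈ 𝔞, ψ a q = 0) → ∃ x, π x = q) :
    Nat.card {q : Q // ∀ a ∈ 𝔞, ψ a q = 0} = Nat.card {x : Λ ⧸ n • (⊤ : Submodule O Λ) // ∀ a ∈ 𝔞, a • x = 0} := by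
  classical
  set T : Submodule O Λ := n • ⊤
  -- the induced injection `Λ⧸T → Q`, `x̄ ↦ π x`
  let πbar : Λ ⧸ T → Q := fun z => Quotient.liftOn' z π (fun x y hxy => by
    rw [Submodule.quotientRel_def] at hxy
    have h0 : π (x - y) = 0 := (hker _).mpr hxy
    rwa [map_sub, sub_eq_zero] at h0)
  have hπbar : ∀ x : Λ, πbar (Submodule.Quotient.mk x) = π x := fun x => rfl
  have hinj : Function.Injective πbar := by
    intro z₁ z₂ h
    obtain ⟨x₁, rfl⟩ := Submodule.mkQ_surjective T z₁
    obtain ⟨x₂, rfl⟩ := Submodule.mkQ_surjective T z₂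
    rw [Submodule.mkQ_apply, Submodule.mkQ_apply, hπbar, hπbar] at h
    rw [Submodule.mkQ_apply, Submodule.mkQ_apply, Submodule.Quotient.eq, ← hker, map_sub, h, sub_self]
  have hsmul : ∀ (a : O) (x : Λ), πbar (a • Submodule.Quotient.mk x) = ψ a (πbar (Submodule.Quotient.mk x)) := by
    intro a x
    rw [← Submodule.Quotient.mk_smul, hπbar, hπbar, hcomp]
  have hmem : ∀ z : Λ ⧸ T, (∀ a ∈ 𝔞, a • z = 0) → ∀ a ∈ 𝔞, ψ a (πbar z) = 0 := by
    intro z hz a ha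
    obtain ⟨x, rfl⟩ := Submodule.mkQ_surjective T z
    rw [Submodule.mkQ_apply] at hz ⊢
    rw [← hsmul, hz a ha, ← Submodule.Quotient.mk_zero, hπbar, map_zero]
  let f : {x : Λ ⧸ T // ∀ a ∈ 𝔞, a • x = 0} → {q : Q // ∀ a ∈ 𝔞, ψ a q = 0} := fun z => ⟨πbar z.1, hmem z.1 z.2⟩
  refine (Nat.card_congr (Equiv.ofBijective f ⟨?_, ?_⟩)).symm
  · intro z₁ z₂ h
    exact Subtype.ext (hinj (congrArg Subtype.val h))
  · rintro ⟨q, hq⟩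
    obtain ⟨x, hx⟩ := hrange q hq
    refine ⟨⟨Submodule.Quotient.mk x, fun a ha => ?_⟩, Subtype.ext ?_⟩
    · apply hinj
      rw [hsmul, hπbar, hx, hq a ha, ← Submodule.Quotient.mk_zero, hπbar, map_zero]
    · change πbar (Submodule.Quotient.mk x) = q
      rw [hπbar, hx]

/-- **Presentation-free prime count: `#{q ∈ Q | 𝔮 q = 0} = #(𝒪⧸𝔮) ^ rk_𝒪 Λ`** for a maximal `𝔮 ∋ n`, `n ≠ 0`, `𝒪` Dedekind, `Λ`
finitely generated torsion-free, and any presentation `π : Λ → Q` of `Λ⧸nΛ` as in `natCard_subtype_torsion_eq_of_presentation`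
(e.g. `Q = A[n](ℂ)`, `π : H₁(A(ℂ);ℤ) → A[n](ℂ)` the monodromy of `x ↦ xⁿ`, `ψ a` the action of `ι(a) ∈ End A`).
[cite: DummitFoote2004, §16.3 Thm. 22] -/
theorem natCard_subtype_torsion_of_presentation_of_isMaximal [IsDedekindDomain O] [Module.Finite O Λ]
    [Module.IsTorsionFree O Λ] (ψ : O → Q → Q) (𝔮 : Ideal O) [𝔮.IsMaximal] {n : O} (hn : n ≠ 0) (hn𝔮 : n ∈ 𝔮)
    (π : Λ →+ Q) (hker : ∀ x, π x = 0 ↔ x ∈ n • (⊤ : Submodule O Λ)) (hcomp : ∀ a x, π (a • x) = ψ a (π x))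
    (hrange : ∀ q, (∀ a ∈ 𝔮, ψ a q = 0) → ∃ x, π x = q) :
    Nat.card {q : Q // ∀ a ∈ 𝔮, ψ a q = 0} = Nat.card (O ⧸ 𝔮) ^ finrank O Λ := by
  rw [natCard_subtype_torsion_eq_of_presentation ψ 𝔮 n π hker hcomp hrange]
  exact natCard_subtype_quotient_torsion_of_isMaximal 𝔮 hn hn𝔮

/-- **Presentation-free count for all nonzero ideals: `#{q ∈ Q | 𝔞 q = 0} = N𝔞 ^ rk_𝒪 Λ`** for `0 ≠ n ∈ 𝔞`, `𝒪` a Dedekind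
`ℤ`-order, `Λ` finitely generated torsion-free, along any presentation `π : Λ → Q` of `Λ⧸nΛ`. [cite: DummitFoote2004, §16.3 Thm. 22] -/
theorem natCard_subtype_torsion_of_presentation_eq_absNorm_pow [IsDedekindDomain O] [Module.Free ℤ O] [Module.Finite ℤ O]
    [Module.Finite O Λ] [Module.IsTorsionFree O Λ] (ψ : O → Q → Q) (𝔞 : Ideal O) (h𝔞 : 𝔞 ≠ ⊥) {n : O} (hn : n ≠ 0)
    (hn𝔞 : n ∈ 𝔞) (π : Λ →+ Q) (hker : ∀ x, π x = 0 ↔ x ∈ n • (⊤ : Submodule O Λ))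
    (hcomp : ∀ a x, π (a • x) = ψ a (π x)) (hrange : ∀ q, (∀ a ∈ 𝔞, ψ a q = 0) → ∃ x, π x = q) :
    Nat.card {q : Q // ∀ a ∈ 𝔞, ψ a q = 0} = Ideal.absNorm 𝔞 ^ finrank O Λ := by
  rw [natCard_subtype_torsion_eq_of_presentation ψ 𝔞 n π hker hcomp hrange]
  exact natCard_subtype_quotient_torsion 𝔞 h𝔞 hn hn𝔞

end Transport

end Literature.Algebra.Module.DedekindLattice
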